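import Summits.PneNP.PneNP.Theorems.SymmetryBudgetWindowCanoniserSemMain3

/-!
# Window canoniser, XXII: gate semantics of the main computation — pasting the parts, the value bits

Route `PneNP/SymmetryBudget`, dichotomy `WindowBarrier` (stmt-PneNP-2145) / `NoHiddenOrder` (stmt-PneNP-14781);
continuation of `…WindowCanoniserSemMain3.lean`.  `samePart p q ↔ WCan.samePartP` (positions `p`, `q` lie in
the same component slot), `spc p w ↔ WCan.spcP` (the vertex at position `p` has the colour of `w`), the section
value bits `svadj`/`svext`/`svcrk` (`WCan.svP`), and finally **`vbit`** (`WCan.ev_aVbit_leaf`,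
`WCan.ev_aVbit_main`: static at a leaf; else the lifted bits of a best candidate when the final state is
connected, the pasted section bits otherwise; positions off `U` forced false) and the reporting formula
`nonbotF` (`WCan.NBP_iff`).  The ambient vertex is immaterial (`WCan.ev_aVbit_irrel`, `WCan.NBP_irrel`).
-/

-- `Summit.PneNP.PneNP.…` duplicates `PneNP` BY DESIGN (single-problem summit, D-0017 layout).
set_option linter.dupNamespace false

noncomputable section

namespace Summit.PneNP.PneNP.Theorems

namespace WCan

open Finset Literature.Computability.Complexity Literature.Computability.Complexity.CGCanon
  Literature.Combinatorics.SimpleGraph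
open scoped Classical

variable {K r n : ℕ}

section MathSide

variable [NeZero n] (L : Lab K n) (x : Fin (r + n) × Fin (r + n) → Bool)

/-- Position `p` lies in the block of `u` at inner offset `o` (some slot). -/
def offP (p u o : Fin n) : Prop := ∃ i, patP (r := r) L x p u i o

/-- Positions `p`, `q` lie in the SAME COMPONENT SLOT of the same block. -/
def samePartP (p q : Fin n) : Prop := ∃ u i, (∃ o, patP (r := r) L x p u i o) ∧ ∃ o, patP (r := r) L x q u i o

/-- The vertex at position `p` HAS THE COLOUR OF `w`. -/
def spcP (p w : Fin n) : Prop := ∃ u o, offP (r := r) L x p u o ∧ ∃ U', isPartP (r := r) L x u U' ∧ pcPP (r := r) L x U' o w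

/-- The SECTION VALUE BITS: adjacency inside a component slot from the part's own bits, across slots from the
switching rule; outside bits and colour ranks through the offsets. -/
def svP : BIdx r n → Prop
  | .adj p q => (samePartP (r := r) L x p q ∧ ∃ u o o', offP (r := r) L x p u o ∧ offP (r := r) L x q u o' ∧
        pbitP (r := r) L x u (bpVal (benc (.adj o o')))) ∨
      (¬ samePartP (r := r) L x p q ∧ ∃ w w', spcP (r := r) L x p w ∧ spcP (r := r) L x q w' ∧ swP x (finSt L.1 x) w w')
  | .ext p o => ∃ u oo, offP (r := r) L x p u oo ∧ pbitP (r := r) L x u (bpVal (benc (.ext oo o)))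
  | .crk p j => ∃ w, spcP (r := r) L x p w ∧ rankF L.1 x w = j

/-- Positions IN RANGE: below `|U|`. -/
def inRng (U : Finset (Fin n)) : BIdx r n → Prop
  | .adj p q => (p : ℕ) < U.card ∧ (q : ℕ) < U.card
  | .ext p _ => (p : ℕ) < U.card
  | .crk p _ => (p : ℕ) < U.card

/-- The STATIC VALUE of a leaf label with the single vertex `u₀`. -/
def leafP (u₀ : Fin n) : BIdx r n → Prop
  | .adj _ _ => False
  | .ext p o => (p : ℕ) = 0 ∧ xo x u₀ o = true
  | .crk p j => (p : ℕ) = 0 ∧ (j : ℕ) = 0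

end MathSide

variable [NeZero n] {L : Lab K n} {x : Fin (r + n) × Fin (r + n) → Bool} (hn : 2 ≤ n)
include hn

/-! ### Pasting -/

omit [NeZero n] hn in
/-- Existence over `Fin (a + b)` splits. -/
theorem exists_fin_add {a b : ℕ} (P : Fin (a + b) → Prop) : (∃ i, P i) ↔ (∃ i, P (Fin.castAdd b i)) ∨ ∃ j, P (Fin.natAdd a j) := by
  constructor
  · rintro ⟨i, hi⟩
    induction i using Fin.addCases with
    | left i => exact Or.inl ⟨i, hi⟩
    | right j => exact Or.inr ⟨j, hi⟩
  · rintro (⟨i, hi⟩ | ⟨j, hj⟩); exacts [⟨_, hi⟩, ⟨_, hj⟩]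

/-- `samePart p q`. -/
theorem ev_aSamePart (p q z : Fin n) : ev x (aSamePart L p q z) = decide (samePartP (r := r) L x p q) := by
  apply Bool.eq_iff_iff.2
  show Vl K x _ = true ↔ _
  rw [Vl_eq, decide_eq_true_iff]
  show (GateFn.or (n * n)).2 (fun k => GateDAG.wire x (Vl K x) (Kind.argsM L .samePart (prm (vec1 z) (ns := nvec2 p q)) k)) = true ↔ _
  simp only [GateFn.or, decide_eq_true_iff, Kind.argsM, prm_ns, nvec2_0, nvec2_1, wire_w1]
  have key : ∀ u i : Fin n, Vl K x (.f1 (n1and [pos (aBlkI L p u i), pos (aBlkI L q u i)])) = true ↔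
      ((∃ o, patP (r := r) L x p u i o) ∧ ∃ o, patP (r := r) L x q u i o) := by
    intro u i; rw [Vl_n1and x _ (by simp)]; simp [ev_aBlkI hn]
  constructor
  · rintro ⟨k, hk⟩; rw [key] at hk; exact ⟨_, _, hk⟩
  · rintro ⟨u, i, h⟩; exact ⟨finProdFinEquiv (u, i), by rw [Equiv.symm_apply_apply, key]; exact h⟩

/-- `off p u o`, named. -/
theorem ev_aOff' (p u o : Fin n) : ev x (aOff L p u o) = decide (offP (r := r) L x p u o) := by
  rw [ev_aOff hn]; apply Bool.eq_iff_iff.2; simp only [decide_eq_true_iff, offP]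

/-- `spc p w`. -/
theorem ev_aSpc (p w : Fin n) : ev x (aSpc L p w) = decide (spcP (r := r) L x p w) := by
  apply Bool.eq_iff_iff.2
  show Vl K x _ = true ↔ _
  rw [Vl_eq, decide_eq_true_iff]
  show (GateFn.or (n * n)).2 (fun k => GateDAG.wire x (Vl K x) (Kind.argsM L .spc (prm (vec1 w) (ns := nvec1 p)) k)) = true ↔ _
  simp only [GateFn.or, decide_eq_true_iff, Kind.argsM, prm_ns, prm_vs, vec1_apply, nvec1_apply, wire_w1]
  have key : ∀ u o : Fin n, Vl K x (.f1 (n1and [pos (aOff L p u o), pos (aPpc L u o w)])) = true ↔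
      (offP (r := r) L x p u o ∧ ∃ U', isPartP (r := r) L x u U' ∧ pcPP (r := r) L x U' o w) := by
    intro u o; rw [Vl_n1and x _ (by simp)]; simp [ev_aOff' hn, ev_aPpc hn]
  constructor
  · rintro ⟨k, hk⟩; rw [key] at hk; exact ⟨_, _, hk⟩
  · rintro ⟨u, o, h⟩; exact ⟨finProdFinEquiv (u, o), by rw [Equiv.symm_apply_apply, key]; exact h⟩

/-- `svadj p q`. -/
theorem ev_aSvadj (p q z : Fin n) : ev x (aSvadj L p q z) = decide (svP (r := r) L x (.adj p q)) := by
  have hT := corr_fin (L := L) (x := x) hn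
  apply Bool.eq_iff_iff.2
  show Vl K x _ = true ↔ _
  rw [Vl_eq, decide_eq_true_iff]
  show (GateFn.or (n * n * n + n * n)).2 (fun k => GateDAG.wire x (Vl K x)
    (Kind.argsM L .svadj (prm (vec1 z) (ns := nvec2 p q)) k)) = true ↔ _
  simp only [GateFn.or, decide_eq_true_iff, Kind.argsM, prm_ns, prm_vs, vec1_apply, nvec2_0, nvec2_1]
  rw [exists_fin_add]
  simp only [Fin.append_left, Fin.append_right, wire_w1]
  have key1 : ∀ (u o o' : Fin n), Vl K x (.f1 (n1and [pos (aSamePart L p q z), pos (aOff L p u o), pos (aOff L q u o'),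
      pos (aPbit L u (bpVal (benc (.adj o o'))))])) = true ↔
      (samePartP (r := r) L x p q ∧ offP (r := r) L x p u o ∧ offP (r := r) L x q u o' ∧
        pbitP (r := r) L x u (bpVal (benc (.adj o o')))) := by
    intro u o o'; rw [Vl_n1and x _ (by simp)]; simp [ev_aSamePart hn, ev_aOff' hn, ev_aPbit hn]
  have key2 : ∀ (w w' : Fin n), Vl K x (.f1 (n1and [neg (aSamePart L p q z), pos (aSpc L p w), pos (aSpc L q w'),
      pos (aSw L (tf n) w w')])) = true ↔
      (¬ samePartP (r := r) L x p q ∧ spcP (r := r) L x p w ∧ spcP (r := r) L x q w' ∧ swP x (finSt L.1 x) w w') := by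
    intro w w'; rw [Vl_n1and x _ (by simp)]; simp [ev_aSamePart hn, ev_aSpc hn, ev_aSw hT]
  simp only [key1, key2, svP]
  apply or_congr
  · constructor
    · rintro ⟨k, h1, h2⟩; exact ⟨h1, _, _, _, h2⟩
    · rintro ⟨h1, u, o, o', h2⟩
      exact ⟨finProdFinEquiv (finProdFinEquiv (u, o), o'), by simpa using And.intro h1 h2⟩
  · constructor
    · rintro ⟨k, h1, h2⟩; exact ⟨h1, _, _, h2⟩
    · rintro ⟨h1, w, w', h2⟩; exact ⟨finProdFinEquiv (w, w'), by simpa using And.intro h1 h2⟩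

/-- `svext p o`. -/
theorem ev_aSvext (p : Fin n) (o : Fin r) (z : Fin n) : ev x (aSvext L p o z) = decide (svP (r := r) L x (.ext p o)) := by
  apply Bool.eq_iff_iff.2
  show Vl K x _ = true ↔ _
  rw [Vl_eq, decide_eq_true_iff]
  show (GateFn.or (n * n)).2 (fun k => GateDAG.wire x (Vl K x)
    (Kind.argsM L .svext (prm (vec1 z) (ns := nvec1 p) (o1 := some o)) k)) = true ↔ _
  simp only [GateFn.or, decide_eq_true_iff, Kind.argsM, prm_ns, prm_o1, nvec1_apply, wire_w1]
  have key : ∀ u oo : Fin n, Vl K x (.f1 (n1and [pos (aOff L p u oo), pos (aPbit L u (bpVal (benc (.ext oo o))))])) = true ↔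
      (offP (r := r) L x p u oo ∧ pbitP (r := r) L x u (bpVal (benc (.ext oo o)))) := by
    intro u oo; rw [Vl_n1and x _ (by simp)]; simp [ev_aOff' hn, ev_aPbit hn]
  simp only [key, svP]
  constructor
  · rintro ⟨k, hk⟩; exact ⟨_, _, hk⟩
  · rintro ⟨u, oo, h⟩; exact ⟨finProdFinEquiv (u, oo), by simpa using h⟩

/-- `svcrk p j`. -/
theorem ev_aSvcrk (p j z : Fin n) : ev x (aSvcrk L p j z) = decide (svP (r := r) L x (.crk p j)) := by
  apply Bool.eq_iff_iff.2
  show Vl K x _ = true ↔ _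
  rw [Vl_eq, decide_eq_true_iff]
  show (GateFn.or n).2 (fun w => GateDAG.wire x (Vl K x) (Kind.argsM L .svcrk (prm (vec1 z) (ns := nvec2 p j)) w)) = true ↔ _
  simp only [GateFn.or, decide_eq_true_iff, Kind.argsM, prm_ns, nvec2_0, nvec2_1, wire_w2, svP]
  refine exists_congr fun w => ?_
  rw [Vl_n2and x _ (by simp)]
  simp [Vl_litN1, Vl_rkF hn, ev_aSpc hn]

/-! ### The value bits -/

omit hn in
/-- The static leaf wire. -/
theorem wire_leafBitW (b : Fin (NB r n)) : GateDAG.wire x (Vl K x) (leafBitW L b) = true ↔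
    ∃ h : L.1.U.card = 1, leafP x (Classical.choose (Finset.card_eq_one.1 h)) (bdec b) := by
  unfold leafBitW
  by_cases h : L.1.U.card = 1
  · simp only [h, ↓reduceDIte, exists_true_left]
    rcases bdec b with ⟨p, q⟩ | ⟨p, o⟩ | ⟨p, j⟩
    · simp [leafP]
    · simp only [leafP]
      split_ifs with hp
      · rw [wire_wA, ev_aExO]; simp [hp]
      · simp only [wire_wA, ev_ff, Bool.false_eq_true, false_iff, not_and]; intro h'; exact absurd h' hp
    · simp only [leafP]
      split_ifs with hp
      · simp only [wire_wA, ev_tt, true_iff]; exact hp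
      · simp only [wire_wA, ev_ff, Bool.false_eq_true, false_iff]; exact hp
  · simp [h]

omit hn in
/-- **`vbit` at a leaf label** is the static leaf value. -/
theorem ev_aVbit_leaf (hU : L.1.U.card ≤ 1) (z : Fin n) (b : Fin (NB r n)) : ev x (aVbit L z b) = true ↔
    ∃ h : L.1.U.card = 1, leafP x (Classical.choose (Finset.card_eq_one.1 h)) (bdec b) := by
  show Vl K x _ = true ↔ _
  rw [Vl_eq]
  show (GateFn.and 1).2 (fun i => GateDAG.wire x (Vl K x) (Kind.argsM L .vbit (prm (vec1 z) (b := b.castSucc)) i)) = true ↔ _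
  simp only [GateFn.and, Kind.argsM, prm_b, Fin.val_castSucc, Fin.is_lt, ↓reduceDIte, Fin.eta, hU, ↓reduceIte,
    Fin.forall_fin_one, wire_leafBitW, decide_eq_true_iff]

/-- **`vbit` at an inner label**: in range, and — the lifted bit of a best candidate if the final state is
connected, the pasted section bit otherwise. -/
theorem ev_aVbit_main (hU : ¬ L.1.U.card ≤ 1) (z : Fin n) (b : Fin (NB r n)) : ev x (aVbit L z b) = true ↔
    (inRng L.1.U (bdec b) ∧
      ((IsConn (G x) (finSt L.1 x).W (finSt L.1 x).c ∧ ∃ κ, bestP (r := r) L x κ ∧ lvec L x κ b = true) ∨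
       (¬ IsConn (G x) (finSt L.1 x).W (finSt L.1 x).c ∧ svP (r := r) L x (bdec b)))) := by
  have hT := corr_fin (L := L) (x := x) hn
  show Vl K x _ = true ↔ _
  rw [Vl_eq]
  show (GateFn.and 1).2 (fun i => GateDAG.wire x (Vl K x) (Kind.argsM L .vbit (prm (vec1 z) (b := b.castSucc)) i)) = true ↔ _
  simp only [GateFn.and, Kind.argsM, prm_b, prm_vs, vec1_apply, Fin.val_castSucc, Fin.is_lt, ↓reduceDIte, Fin.eta, hU,
    ↓reduceIte, Fin.forall_fin_one, decide_eq_true_iff]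
  have inner : ∀ (svA : Atom K r n) (PsvA : Prop), (ev x svA = true ↔ PsvA) →
      (GateDAG.wire x (Vl K x) (w2 (n2or [n1and [pos (aConn L (tf n) z), pos (aIvbit L z b)],
        n1and [neg (aConn L (tf n) z), pos svA]])) = true ↔
      ((IsConn (G x) (finSt L.1 x).W (finSt L.1 x).c ∧ ∃ κ, bestP (r := r) L x κ ∧ lvec L x κ b = true) ∨
       (¬ IsConn (G x) (finSt L.1 x).W (finSt L.1 x).c ∧ PsvA))) := by
    intro svA PsvA hsv
    rw [wire_w2, Vl_n2or x _ (by simp)]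
    simp only [List.mem_cons, List.not_mem_nil, or_false, exists_eq_or_imp, exists_eq_left]
    rw [Vl_n1and x _ (by simp), Vl_n1and x _ (by simp)]
    simp [ev_aConn hT, ev_aIvbit, hsv, Prod.exists]
  rcases hb : bdec b with ⟨p, q⟩ | ⟨p, o⟩ | ⟨p, j⟩
  · simp only [inRng]
    by_cases hin : (p : ℕ) < L.1.U.card ∧ (q : ℕ) < L.1.U.card
    · rw [decide_eq_true hin, if_pos rfl, inner _ _ (by rw [ev_aSvadj hn, decide_eq_true_iff])]; simp [hin]
    · rw [decide_eq_false hin, if_neg Bool.false_ne_true]; simp [hin]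
  · simp only [inRng]
    by_cases hin : (p : ℕ) < L.1.U.card
    · rw [decide_eq_true hin, if_pos rfl, inner _ _ (by rw [ev_aSvext hn, decide_eq_true_iff])]; simp [hin]
    · rw [decide_eq_false hin, if_neg Bool.false_ne_true]; simp [hin]
  · simp only [inRng]
    by_cases hin : (p : ℕ) < L.1.U.card
    · rw [decide_eq_true hin, if_pos rfl, inner _ _ (by rw [ev_aSvcrk hn, decide_eq_true_iff])]; simp [hin]
    · rw [decide_eq_false hin, if_neg Bool.false_ne_true]; simp [hin]

/-- The value bits do not depend on the ambient vertex. -/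
theorem ev_aVbit_irrel (z z' : Fin n) (b : Fin (NB r n)) : ev x (aVbit L z b) = ev x (aVbit (r := r) L z' b) := by
  apply Bool.eq_iff_iff.2
  by_cases hU : L.1.U.card ≤ 1
  · rw [ev_aVbit_leaf hU, ev_aVbit_leaf hU]
  · rw [ev_aVbit_main hn hU, ev_aVbit_main hn hU]

/-- **The reporting formula**: a leaf always reports; an inner label reports a best candidate when its final
state is connected, all parts certified otherwise. -/
theorem NBP_iff (z : Fin n) : NBP (r := r) L x z ↔ (L.1.U.card ≤ 1 ∨
    (IsConn (G x) (finSt L.1 x).W (finSt L.1 x).c ∧ ∃ κ, certP (r := r) L x κ) ∨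
    (¬ IsConn (G x) (finSt L.1 x).W (finSt L.1 x).c ∧ ∀ u ∈ L.1.U, ev x (aPcov (r := r) L u) = true)) := by
  have hT := corr_fin (L := L) (x := x) hn
  unfold NBP nonbotF
  by_cases hU : L.1.U.card ≤ 1
  · simp only [hU, ↓reduceIte, true_or, iff_true]
    rw [Vl_n2and x _ (by simp)]; simp
  · simp only [hU, ↓reduceIte, false_or]
    rw [Vl_n2or x _ (by simp)]
    simp only [List.mem_cons, List.not_mem_nil, or_false, exists_eq_or_imp, exists_eq_left]
    rw [Vl_n1and x _ (by simp), Vl_n1and x _ (by simp)]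
    simp [ev_aConn hT, ev_aInonbot, ev_aPnonbot]

/-- Reporting does not depend on the ambient vertex. -/
theorem NBP_irrel (z z' : Fin n) : NBP (r := r) L x z ↔ NBP (r := r) L x z' := by
  rw [NBP_iff hn, NBP_iff hn]

/-- Hence neither does the certification of a part child. -/
theorem certS_irrel (U' : Finset (Fin n)) (z z' : Fin n) : certS (r := r) L x U' z ↔ certS (r := r) L x U' z' := by
  unfold certS
  rw [ev_aCert_inr hn, ev_aCert_inr hn, decide_eq_true_iff, decide_eq_true_iff]
  simp only [thruR, Bool.true_eq_false, false_implies, and_true]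
  constructor
  · rintro ⟨Lc, h1, h2, h3, h4⟩; exact ⟨Lc, h1, h2, h3, (NBP_irrel (L := Lc) hn z z').1 h4⟩
  · rintro ⟨Lc, h1, h2, h3, h4⟩; exact ⟨Lc, h1, h2, h3, (NBP_irrel (L := Lc) hn z z').2 h4⟩

end WCan

end Summit.PneNP.PneNP.Theorems

end
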